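import Summits.CriticalPhenomena.SAWScalingLimit.Theorems.SAWDevelopingMapHexConjectureFarSideTriangleTail
import Summits.CriticalPhenomena.SAWScalingLimit.Theorems.SAWDevelopingMapHexConjectureTwoPointTailBound
import HarnessLib

/-!
# Crux `HexConjecture` (stmt-CriticalPhenomena-0808), line `root-locality-replaces-loewner` (lead c8):
the fixed-scale split of the strip's floor-arch tail

Landing target:
`Summits/CriticalPhenomena/SAWScalingLimit/Theorems/SAWDevelopingMapHexConjectureTailSplitFixedScale.lean`
(`--supports stmt-CriticalPhenomena-0808`; registered stub `stub_tailSplit_fixedScale`).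

The lever of the line is the WINDOW TWO-POINT LOWER BOUND (`triDl ⌊R/4⌋ ≤ C Σ_{d ∈ [θa R, θb R]} Z_{B_R}(s_x → t_d)`);
the lead derives it from a tail-fraction statement about the coded floor-arch sums
`coded_N(d) = Σ_{P coded walk of S_{N+1,N+1} exiting at the floor mid-edge of abscissa d} x_c^{ℓ(P)}` of the
Duminil-Copin–Smirnov strips and a drop property of the triangle far side.  This file is the lattice heart at
FIXED scales `T + 1 ≤ T2 ≤ R/4`, `R ≥ 12`: with `D_N = [-(N+1), N+1] ∖ {0}` and the upper half-box
`B = {v : x₁ ≤ row v, dist(c_v, mid s_x) ≤ R}`,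

  `Σ_{d ∈ D_N, |d| ≥ T+1} coded_N(d)
      ≤ 2 Σ_{d = T+1}^{T2} Z_B(s_x → t_{x + d e₀}) + 2 (1/cos(3π/8) − A^Δ(⌊R/3⌋ − 1)) + (1/cos(3π/8) − A^Δ(T2))`
  (`tailSplit_fixedScale`, registered as `stub_tailSplit_fixedScale`).

Mechanism.  Split the offsets `F = {d ∈ D_N : |d| ≥ T + 1}` into `F₁ = {|d| ≤ T2}` and `F₂ = {|d| ≥ T2 + 1}`.
(a) On `F₂` the coded sums are the floor arch masses of the half-strip `S_x(N)` (`archMass_halfStrip_offset`)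
and weigh at most the triangle tail `1/cos(3π/8) − A^Δ(T2)` (`farOffsetMass_le_sub_triA`, Krachun–Panagiotis
Lemma 2.2).  (b) `F₁` is symmetric under `d ↦ −d` and the coded sums are even in `d` (hypothesis, the strip's
reflection symmetry), so `Σ_{F₁} = 2 Σ_{F₁⁺}`.  (c) For `d ∈ F₁⁺` exact restriction splits
`Z_{S_x(N)}(d) ≤ Z_B(d) + Far^R_{S_x(N)}(d)` (`archMass_le_archMass_add_farMass`: a walk of the strip staying
within distance `< R` of `mid s_x` is a walk of `B`).  (d) The summed far masses weigh at most the triangle tail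
`1/cos(3π/8) − A^Δ(⌊R/3⌋ − 1)` (`farArchMass_offsetSum_le_sub_triA`, as `3(⌊R/3⌋ − 1) + 2 < R`).  (e) `F₁⁺ ⊆ [T+1, T2]`
and arch masses are nonnegative.
Sources: DuminilCopinSmirnov2012 (Lemma 2, §3), GlazmanManolescu2019 (Lemma 4.1), LawlerSchrammWerner2004SAW (§3.4).
-/

noncomputable section

open scoped BigOperators Topology Classical
open Filter Set
open Literature.Probability.LatticeModels (HexVertex hexGraph hexCenter Site)
open Literature.Probability.RandomPlanarGeometry
open Literature.Probability.RandomPlanarGeometry.SAW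
open Literature.Probability.RandomPlanarGeometry.SAW.HV
open Summit.CriticalPhenomena.SAWScalingLimit.Theorems.ObservableToSLE.FloorRatio

namespace Summit.CriticalPhenomena.SAWScalingLimit.Theorems.HexConjecture.RootLocality

/-! ### Offset bookkeeping -/

/-- Membership in the tail window `{d ∈ D_N : |d| ≥ T + 1}`. [folklore] -/
theorem tailSplit_mem_tailWindow_iff {N T : ℕ} {d : ℤ} :
    d ∈ ((Finset.Icc (-((N : ℤ) + 1)) ((N : ℤ) + 1)).erase 0).filter (fun d => (T : ℤ) + 1 ≤ |d|) ↔
      d ≠ 0 ∧ |d| ≤ N + 1 ∧ (T : ℤ) + 1 ≤ |d| := by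
  rw [Finset.mem_filter, mem_offsetWindow_iff, and_assoc]

/-- The triangle inscribed at scale `⌊R/3⌋ − 1` fits strictly inside the half-disc of radius `R ≥ 12`:
`3(⌊R/3⌋ − 1) + 2 < R`. [folklore] -/
theorem tailSplit_three_mul_floor_lt {R : ℝ} (hR : 12 ≤ R) :
    3 * (((⌊R / 3⌋₊ - 1 : ℕ)) : ℝ) + 2 < R := by
  have hL1 : 1 ≤ ⌊R / 3⌋₊ := Nat.le_floor (by rw [Nat.cast_one]; linarith)
  rw [Nat.cast_sub hL1, Nat.cast_one]
  have := Nat.floor_le (show (0 : ℝ) ≤ R / 3 by positivity)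
  linarith

/-- The inner endpoint `(x, 0)` of the root mid-edge `s_x` is within distance `1/2` of `mid s_x`, hence lies in
the upper half-box `B` of any radius `R ≥ 1/2`; so `s_x` is a mid-edge of `Ω(B)`. [cite: DuminilCopinSmirnov2012, §2 (domains)] -/
theorem tailSplit_rootEdge_mem_hexDomainMidEdges {x : Site 2} {R : ℝ} {B : Finset HexVertex} (hR : 1 / 2 ≤ R)
    (hB : ∀ v : HexVertex, v ∈ B ↔ (x 1 ≤ v.1 1 ∧
      dist (hexCenter v) (hexMidpoint s((x - Pi.single 1 1, 1), (x, 0))) ≤ R)) :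
    s((x - Pi.single 1 1, 1), (x, 0)) ∈ hexDomainMidEdges B := by
  have he : s((x - Pi.single 1 1, (1 : Fin 2)), (x, (0 : Fin 2))) ∈ hexGraph.edgeSet :=
    (SimpleGraph.mem_edgeSet hexGraph).2 (adj_floorEdge x)
  have hx0 : ((x, 0) : HexVertex) ∈ B :=
    (hB (x, 0)).2 ⟨le_rfl, (dist_hexCenter_hexMidpoint_le he (Sym2.mem_mk_right _ _)).trans hR⟩
  exact ⟨he, (x, 0), Sym2.mem_mk_right _ _, hx0⟩

/-! ### The theorem -/

/-- **THE FIXED-SCALE SPLIT OF THE STRIP'S FLOOR-ARCH TAIL.**  For a cell `x`, scales `T + 1 ≤ T2 ≤ R/4`,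
`R ≥ 12`, the upper half-box `B = {v : x₁ ≤ row v, dist(c_v, mid s_x) ≤ R}` and every `N`: if the coded
floor-arch sums of the strip `S_{N+1,N+1}` are even in the offset, then their tail beyond offset `T` is at most
twice the window two-point mass `Σ_{d = T+1}^{T2} Z_B(s_x → t_{x + d e₀})` of the half-box, plus twice the triangle
tail `1/cos(3π/8) − A^Δ(⌊R/3⌋ − 1)` (the far part of the near offsets, exact restriction + Glazman–Manolescu), plus
the triangle tail `1/cos(3π/8) − A^Δ(T2)` (the offsets beyond `T2`, Krachun–Panagiotis Lemma 2.2).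
[cite: DuminilCopinSmirnov2012, Lemma 2 and §3; GlazmanManolescu2019, Lemma 4.1; LawlerSchrammWerner2004SAW, §3.4] -/
theorem tailSplit_fixedScale (x : Site 2) (N T T2 : ℕ) (R : ℝ) (B : Finset HexVertex)
    (hrefl : ∀ d : ℤ,
      ∑ P ∈ (midWalks (stripV (N + 1) (N + 1))).filter
          (fun P => finalDart P = ((-d, 0, false), (-d, -1, true)) ∨
            finalDart P = ((-d, -1, true), (-d, 0, false))),
          hexCriticalFugacity ^ mwLen P =
      ∑ P ∈ (midWalks (stripV (N + 1) (N + 1))).filter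
          (fun P => finalDart P = ((d, 0, false), (d, -1, true)) ∨
            finalDart P = ((d, -1, true), (d, 0, false))),
          hexCriticalFugacity ^ mwLen P)
    (hR : 12 ≤ R) (_hT : T + 1 ≤ T2) (_hT2 : (T2 : ℝ) ≤ R / 4)
    (hB : ∀ v : HexVertex, v ∈ B ↔ (x 1 ≤ v.1 1 ∧
      dist (hexCenter v) (hexMidpoint s((x - Pi.single 1 1, 1), (x, 0))) ≤ R)) :
    ∑ d ∈ ((Finset.Icc (-((N : ℤ) + 1)) ((N : ℤ) + 1)).erase 0).filter (fun d => (T : ℤ) + 1 ≤ |d|),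
        ∑ P ∈ (midWalks (stripV (N + 1) (N + 1))).filter
            (fun P => finalDart P = ((d, 0, false), (d, -1, true)) ∨
              finalDart P = ((d, -1, true), (d, 0, false))),
          hexCriticalFugacity ^ mwLen P ≤
      2 * (∑ d ∈ Finset.Icc ((T : ℤ) + 1) (T2 : ℤ),
          ∑ γ : HexMidEdgeSAW B s((x - Pi.single 1 1, 1), (x, 0))
            s((x + Pi.single 0 d - Pi.single 1 1, 1), (x + Pi.single 0 d, 0)),
            hexCriticalFugacity ^ γ.length) +
      2 * ((Real.cos (3 * Real.pi / 8))⁻¹ - triA (⌊R / 3⌋₊ - 1)) +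
      ((Real.cos (3 * Real.pi / 8))⁻¹ - triA T2) := by
  have hsB : s((x - Pi.single 1 1, 1), (x, 0)) ∈ hexDomainMidEdges B :=
    tailSplit_rootEdge_mem_hexDomainMidEdges (by linarith) hB
  set s : Sym2 HexVertex := s((x - Pi.single 1 1, 1), (x, 0)) with hs
  set HSN := (stripV (N + 1) (N + 1)).map
    (hvIso.trans (shift (-(x 0)) (-(x 1)))).symm.toEquiv.toEmbedding with hHSN
  set DN := (Finset.Icc (-((N : ℤ) + 1)) ((N : ℤ) + 1)).erase 0 with hDN
  set C : ℤ → ℝ := fun d => ∑ P ∈ (midWalks (stripV (N + 1) (N + 1))).filter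
      (fun P => finalDart P = ((d, 0, false), (d, -1, true)) ∨
        finalDart P = ((d, -1, true), (d, 0, false))),
      hexCriticalFugacity ^ mwLen P with hC
  set Z : Finset HexVertex → ℤ → ℝ := fun Λ' d => ∑ γ : HexMidEdgeSAW Λ' s
      s((x + Pi.single 0 d - Pi.single 1 1, 1), (x + Pi.single 0 d, 0)), hexCriticalFugacity ^ γ.length with hZ
  set Far : ℤ → ℝ := fun d => ∑ γ : HexMidEdgeSAW HSN s
      s((x + Pi.single 0 d - Pi.single 1 1, 1), (x + Pi.single 0 d, 0)),
      (if ∃ v ∈ γ.verts, R ≤ dist (hexCenter v) (hexMidpoint s)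
        then hexCriticalFugacity ^ γ.length else 0) with hFar
  set F := DN.filter (fun d => (T : ℤ) + 1 ≤ |d|) with hF
  set F₁ := F.filter (fun d => |d| ≤ (T2 : ℤ)) with hF₁
  set F₂ := F.filter (fun d => ¬ |d| ≤ (T2 : ℤ)) with hF₂
  set Fp := F₁.filter (fun d => (0 : ℤ) < d) with hFp
  set Fm := F₁.filter (fun d => ¬ (0 : ℤ) < d) with hFm
  -- geometry of the half-strip and of the half-box
  have hΛ : ∀ v ∈ HSN, x 1 ≤ v.1 1 := fun v hv => (halfStrip_geometry hv).1
  have hnear : ∀ v ∈ HSN, dist (hexCenter v) (hexMidpoint s) < R → v ∈ B := fun v hv hd =>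
    (hB v).2 ⟨(halfStrip_geometry hv).1, hd.le⟩
  -- membership bookkeeping
  have hmemF : ∀ {d : ℤ}, d ∈ F ↔ d ≠ 0 ∧ |d| ≤ N + 1 ∧ (T : ℤ) + 1 ≤ |d| := fun {d} =>
    tailSplit_mem_tailWindow_iff
  have hCZ : ∀ d ∈ F, C d = Z HSN d := fun d hd =>
    (archMass_halfStrip_offset x N d (hmemF.1 hd).2.1).symm
  -- (1) split the tail window at `T2`
  have e1 : ∑ d ∈ F, C d = ∑ d ∈ F₁, C d + ∑ d ∈ F₂, C d :=
    (Finset.sum_filter_add_sum_filter_not F (fun d => |d| ≤ (T2 : ℤ)) C).symm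
  -- (2) the offsets beyond `T2`: Krachun–Panagiotis
  have h2 : ∑ d ∈ F₂, C d ≤ (Real.cos (3 * Real.pi / 8))⁻¹ - triA T2 := by
    have e : ∑ d ∈ F₂, C d = ∑ d ∈ F₂, Z HSN d :=
      Finset.sum_congr rfl fun d hd => hCZ d (Finset.mem_filter.1 hd).1
    rw [e]
    refine farOffsetMass_le_sub_triA x HSN hΛ T2 F₂ fun d hd => ?_
    have h := (Finset.mem_filter.1 hd).2
    omega
  -- (3) the near offsets: reflection symmetry
  have e3 : ∑ d ∈ F₁, C d = 2 * ∑ d ∈ Fp, C d := by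
    have hmp : ∑ d ∈ Fm, C d = ∑ d ∈ Fp, C d := by
      refine Finset.sum_nbij' (fun d => -d) (fun d => -d) (fun d hd => ?_) (fun d hd => ?_)
        (fun d _ => neg_neg d) (fun d _ => neg_neg d) (fun d _ => ?_)
      · rw [hFm, Finset.mem_filter, hF₁, Finset.mem_filter, hmemF] at hd
        rw [hFp, Finset.mem_filter, hF₁, Finset.mem_filter, hmemF, abs_neg]
        obtain ⟨⟨⟨h0, hN, hT⟩, hT2⟩, hneg⟩ := hd
        exact ⟨⟨⟨neg_ne_zero.2 h0, hN, hT⟩, hT2⟩, by omega⟩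
      · rw [hFp, Finset.mem_filter, hF₁, Finset.mem_filter, hmemF] at hd
        rw [hFm, Finset.mem_filter, hF₁, Finset.mem_filter, hmemF, abs_neg]
        obtain ⟨⟨⟨h0, hN, hT⟩, hT2⟩, hpos⟩ := hd
        exact ⟨⟨⟨neg_ne_zero.2 h0, hN, hT⟩, hT2⟩, by omega⟩
      · have h := hrefl (-d)
        simp only [neg_neg] at h
        exact h
    rw [← Finset.sum_filter_add_sum_filter_not F₁ (fun d => (0 : ℤ) < d) C]
    show ∑ d ∈ Fp, C d + ∑ d ∈ Fm, C d = 2 * ∑ d ∈ Fp, C d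
    rw [hmp, two_mul]
  -- (4) the positive near offsets: exact restriction towards the half-box
  have h4 : ∀ d ∈ Fp, C d ≤ Z B d + Far d := by
    intro d hd
    have hdF : d ∈ F := (Finset.mem_filter.1 (Finset.mem_filter.1 hd).1).1
    rw [hCZ d hdF]
    exact archMass_le_archMass_add_farMass hsB hnear
  -- (5) the far part: Glazman–Manolescu triangle tail at scale `⌊R/3⌋ − 1`
  have h0Fp : (0 : ℤ) ∉ Fp := fun h => lt_irrefl (0 : ℤ) (Finset.mem_filter.1 h).2
  have h5 : ∑ d ∈ Fp, Far d ≤ (Real.cos (3 * Real.pi / 8))⁻¹ - triA (⌊R / 3⌋₊ - 1) :=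
    farArchMass_offsetSum_le_sub_triA x HSN hΛ Fp h0Fp (⌊R / 3⌋₊ - 1) R
      (tailSplit_three_mul_floor_lt hR)
  -- (6) the near part: the window two-point mass of the half-box
  have hsub : Fp ⊆ Finset.Icc ((T : ℤ) + 1) (T2 : ℤ) := by
    intro d hd
    rw [hFp, Finset.mem_filter, hF₁, Finset.mem_filter, hmemF] at hd
    obtain ⟨⟨⟨-, -, hT⟩, hT2⟩, hpos⟩ := hd
    rw [abs_of_pos hpos] at hT hT2
    exact Finset.mem_Icc.2 ⟨hT, hT2⟩
  have h6 : ∑ d ∈ Fp, Z B d ≤ ∑ d ∈ Finset.Icc ((T : ℤ) + 1) (T2 : ℤ), Z B d :=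
    Finset.sum_le_sum_of_subset_of_nonneg hsub fun d _ _ => archMass_nonneg _ _ _
  -- assembly
  have h45 : ∑ d ∈ Fp, C d ≤ ∑ d ∈ Fp, Z B d + ∑ d ∈ Fp, Far d := by
    rw [← Finset.sum_add_distrib]
    exact Finset.sum_le_sum h4
  show ∑ d ∈ F, C d ≤ 2 * (∑ d ∈ Finset.Icc ((T : ℤ) + 1) (T2 : ℤ), Z B d) +
    2 * ((Real.cos (3 * Real.pi / 8))⁻¹ - triA (⌊R / 3⌋₊ - 1)) +
    ((Real.cos (3 * Real.pi / 8))⁻¹ - triA T2)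
  rw [e1, e3]
  linarith

/-- **Registered stub `stub_tailSplit_fixedScale`** (crux item stmt-CriticalPhenomena-0808, line
`root-locality-replaces-loewner`, lead c8): the fixed-scale split of the strip's floor-arch tail into the window
two-point mass of the half-box, the far part and the beyond-window part (`tailSplit_fixedScale`).
[cite: DuminilCopinSmirnov2012, Lemma 2 and §3; GlazmanManolescu2019, Lemma 4.1; LawlerSchrammWerner2004SAW, §3.4] -/
theorem stub_tailSplit_fixedScale : ∀ (x : Literature.Probability.LatticeModels.Site 2) (N T T2 : ℕ) (R : ℝ)
    (B : Finset Literature.Probability.LatticeModels.HexVertex),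
    (∀ d : ℤ,
      ∑ P ∈ (Literature.Probability.RandomPlanarGeometry.SAW.HV.midWalks
          (Literature.Probability.RandomPlanarGeometry.SAW.HV.stripV (N + 1) (N + 1))).filter
          (fun P => Literature.Probability.RandomPlanarGeometry.SAW.HV.finalDart P = ((-d, 0, false), (-d, -1, true)) ∨
            Literature.Probability.RandomPlanarGeometry.SAW.HV.finalDart P = ((-d, -1, true), (-d, 0, false))),
          Literature.Probability.RandomPlanarGeometry.SAW.hexCriticalFugacity ^
            Literature.Probability.RandomPlanarGeometry.SAW.HV.mwLen P =
      ∑ P ∈ (Literature.Probability.RandomPlanarGeometry.SAW.HV.midWalks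
          (Literature.Probability.RandomPlanarGeometry.SAW.HV.stripV (N + 1) (N + 1))).filter
          (fun P => Literature.Probability.RandomPlanarGeometry.SAW.HV.finalDart P = ((d, 0, false), (d, -1, true)) ∨
            Literature.Probability.RandomPlanarGeometry.SAW.HV.finalDart P = ((d, -1, true), (d, 0, false))),
          Literature.Probability.RandomPlanarGeometry.SAW.hexCriticalFugacity ^
            Literature.Probability.RandomPlanarGeometry.SAW.HV.mwLen P) →
    12 ≤ R → T + 1 ≤ T2 → (T2 : ℝ) ≤ R / 4 →
    (∀ v : Literature.Probability.LatticeModels.HexVertex, v ∈ B ↔ (x 1 ≤ v.1 1 ∧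
      dist (Literature.Probability.LatticeModels.hexCenter v)
        (Literature.Probability.RandomPlanarGeometry.SAW.hexMidpoint s((x - Pi.single 1 1, 1), (x, 0))) ≤ R)) →
    ∑ d ∈ ((Finset.Icc (-((N : ℤ) + 1)) ((N : ℤ) + 1)).erase 0).filter (fun d => (T : ℤ) + 1 ≤ |d|),
        ∑ P ∈ (Literature.Probability.RandomPlanarGeometry.SAW.HV.midWalks
            (Literature.Probability.RandomPlanarGeometry.SAW.HV.stripV (N + 1) (N + 1))).filter
            (fun P => Literature.Probability.RandomPlanarGeometry.SAW.HV.finalDart P = ((d, 0, false), (d, -1, true)) ∨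
              Literature.Probability.RandomPlanarGeometry.SAW.HV.finalDart P = ((d, -1, true), (d, 0, false))),
          Literature.Probability.RandomPlanarGeometry.SAW.hexCriticalFugacity ^
            Literature.Probability.RandomPlanarGeometry.SAW.HV.mwLen P ≤
      2 * (∑ d ∈ Finset.Icc ((T : ℤ) + 1) (T2 : ℤ),
          ∑ γ : Literature.Probability.RandomPlanarGeometry.SAW.HexMidEdgeSAW B
            s((x - Pi.single 1 1, 1), (x, 0))
            s((x + Pi.single 0 d - Pi.single 1 1, 1), (x + Pi.single 0 d, 0)),
            Literature.Probability.RandomPlanarGeometry.SAW.hexCriticalFugacity ^ γ.length) +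
      2 * ((Real.cos (3 * Real.pi / 8))⁻¹ - Literature.Probability.RandomPlanarGeometry.SAW.HV.triA (⌊R / 3⌋₊ - 1)) +
      ((Real.cos (3 * Real.pi / 8))⁻¹ - Literature.Probability.RandomPlanarGeometry.SAW.HV.triA T2) :=
  fun x N T T2 R B hrefl hR hT hT2 hB => tailSplit_fixedScale x N T T2 R B hrefl hR hT hT2 hB

end Summit.CriticalPhenomena.SAWScalingLimit.Theorems.HexConjecture.RootLocality

end
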